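import Summits.ResolutionOfSingularities.ResolutionOfSingularities.Theorems.FrobeniusLadderFRationalResolutionRootAdjoinChart
import Mathlib.RingTheory.Ideal.GoingUp
import HarnessLib

/-!
# Crux `FrobeniusLadder.FRationalResolution` (stmt-ResolutionOfSingularities-15317), line `redirect`,
# stub `stub_diagonalizableQuotientResolution` — item (F2) non-split case: the UNIT-DEGREE SUBGROUP of the root-adjunction
# chart `S̃ = S[w]/(w^d − u)` (`…RootAdjoinChart`) at a prime over `𝔔`, and the complement `C̃ = 0 × ZMod d`

For the `A × ZMod d`-graded chart `S̃` of `…RootAdjoinChart` (`u ∈ S_b`, `d • a = b`) and a prime `𝔔̃` of `S̃` over the prime `𝔔`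
of `S`, let `B` be the unit-degree subgroup of `S` at `𝔔` and `B̃` that of `S̃` at `𝔔̃`. This file is the group bookkeeping
that feeds `…FixedChartOfSummand.exists_fixed_chart_of_isCompl` for the chart `S̃` with `C̃ = 0 × ZMod d`:

* `exists_prime_over` — a prime `𝔔̃` over `𝔔` exists (`S̃` is finite over `S`); `comap_comap_ringEquiv` — it lies over the same
  point of `Spec S₀ ≅ Spec S̃_{(0,0)}`;
* `mem_unitDegrees_of_mem` — `b' ∈ B ⇒ (b', 0) ∈ B̃`; `root_mem_unitDegrees` — `u ∉ 𝔔 ⇒ (a, 1) ∈ B̃` (`w^d = u`, no unit needed);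
  `sub_mem_of_mem_unitDegrees` — `(i, m) ∈ B̃ ⇒ i − m•a ∈ B`;
* ★ `sup_prod_eq_top` — `B ⊔ ⟨a⟩ = ⊤ ⇒ B̃ ⊔ C̃ = ⊤`; ★ `inf_prod_eq_bot` — `j•a ∉ B` for `0 < j < d` ⇒ `B̃ ⊓ C̃ = ⊥`.

So at a point whose unit subgroup `B` is NOT a direct summand but becomes all of `A` together with one more degree `a` of
order `d` modulo `B` (e.g. `B = pℤ/p² < ℤ/p² = A`, `a = 1`, `d = p`), the chart `S̃` satisfies the hypotheses of the split-off step
with complement `C̃` — leaving only `IsRegularRing S̃` near `𝔮` (MEMO-15317-leafhand2-g21 §3). Honest label: helper toward ONE leaf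
stub; no stub, crux or summit closed. No definitions, no named facts, no sorry. [folklore; cite: SGA3, Exp. VIII §4–5]
-/

noncomputable section

-- single-problem summit: the doubled namespace component is forced
set_option linter.dupNamespace false

open DirectSum Polynomial

namespace Summit.ResolutionOfSingularities.ResolutionOfSingularities.Theorems.FRationalResolution.RootAdjoinUnits

universe u v w

variable {k : Type u} [CommRing k] {A : Type w} [DecidableEq A] [AddCommGroup A] {S : Type v}
  [CommRing S] [Algebra k S] (𝒮 : A → Submodule k S) [GradedAlgebra 𝒮]
  (d : ℕ) [NeZero d] (u : S) (a b : A) (hu : u ∈ 𝒮 b) (hab : d • a = b)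
  (𝒯 : A × ZMod d → Submodule k (AdjoinRoot (X ^ d - C u : S[X])))
  (h𝒯 : ∀ (p : A × ZMod d) (x : AdjoinRoot (X ^ d - C u : S[X])), x ∈ 𝒯 p ↔
    ∃ c ∈ 𝒮 (p.1 - p.2.val • a),
      x = AdjoinRoot.of (X ^ d - C u : S[X]) c * AdjoinRoot.root (X ^ d - C u : S[X]) ^ p.2.val)

/-! ### A prime over `𝔔` -/

omit [NeZero d] in
/-- A prime of `S̃` over a given prime of `S` exists (`S̃` is integral over `S`, `of` is injective). [folklore] -/
theorem exists_prime_over [Nontrivial S] [NeZero d] (𝔔 : Ideal S) [𝔔.IsPrime] :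
    ∃ 𝔔' : Ideal (AdjoinRoot (X ^ d - C u : S[X])), 𝔔'.IsPrime ∧
      𝔔'.comap (AdjoinRoot.of (X ^ d - C u : S[X])) = 𝔔 := by
  haveI := RootAdjoinChart.module_finite d u
  haveI : Algebra.IsIntegral S (AdjoinRoot (X ^ d - C u : S[X])) := Algebra.IsIntegral.of_finite S _
  have hker : (⊥ : Ideal (AdjoinRoot (X ^ d - C u : S[X]))).comap
      (algebraMap S (AdjoinRoot (X ^ d - C u : S[X]))) ≤ 𝔔 := by
    rw [AdjoinRoot.algebraMap_eq]
    exact Ideal.comap_bot_le_of_injective _ (RootAdjoinChart.of_injective d u)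
  obtain ⟨Q, -, hQ, hQc⟩ := Ideal.exists_ideal_over_prime_of_isIntegral 𝔔 ⊥ hker
  exact ⟨Q, hQ, by rwa [AdjoinRoot.algebraMap_eq] at hQc⟩

include h𝒯 in
omit [DecidableEq A] [GradedAlgebra 𝒮] [NeZero d] in
/-- **Same point of the quotient.** Under `S_0 ≃+* S̃_{(0,0)}` (`…RootAdjoinChart.exists_ringEquiv_gradeZero`) the contraction of `𝔔̃`
to `S̃_{(0,0)}` corresponds to the contraction of `𝔔 = 𝔔̃ ∩ S` to `S_0`. [folklore] -/
theorem comap_comap_ringEquiv [SetLike.GradedMonoid 𝒮] [SetLike.GradedMonoid 𝒯]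
    (𝔔' : Ideal (AdjoinRoot (X ^ d - C u : S[X]))) (e : 𝒮 0 ≃+* 𝒯 0)
    (he : ∀ x : 𝒮 0, (e x : AdjoinRoot (X ^ d - C u : S[X])) = AdjoinRoot.of (X ^ d - C u : S[X]) x) :
    (𝔔'.comap (algebraMap (𝒯 0) (AdjoinRoot (X ^ d - C u : S[X])))).comap e.toRingHom =
      (𝔔'.comap (AdjoinRoot.of (X ^ d - C u : S[X]))).comap (algebraMap (𝒮 0) S) := by
  have _ := h𝒯
  ext x
  simp only [Ideal.mem_comap, RingEquiv.toRingHom_eq_coe, RingHom.coe_coe]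
  change (e x : AdjoinRoot (X ^ d - C u : S[X])) ∈ 𝔔' ↔ AdjoinRoot.of (X ^ d - C u : S[X]) (x : S) ∈ 𝔔'
  rw [he]

/-! ### The unit-degree subgroup of `S̃` -/

section Units

variable (𝔔 : Ideal S) (𝔔' : Ideal (AdjoinRoot (X ^ d - C u : S[X])))
  (h𝔔' : 𝔔'.comap (AdjoinRoot.of (X ^ d - C u : S[X])) = 𝔔)
  (B : AddSubgroup A) (hB : ∀ i : A, i ∈ B ↔ ∃ s ∈ 𝒮 i, s ∉ 𝔔)
  (B' : AddSubgroup (A × ZMod d))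
  (hB' : ∀ p : A × ZMod d, p ∈ B' ↔ ∃ x ∈ 𝒯 p, x ∉ 𝔔')

include h𝒯 h𝔔' hB hB'

omit [DecidableEq A] [GradedAlgebra 𝒮] [NeZero d] in
/-- `b' ∈ B ⇒ (b', 0) ∈ B̃`. [folklore] -/
theorem mem_unitDegrees_of_mem {i : A} (hi : i ∈ B) : (i, (0 : ZMod d)) ∈ B' := by
  obtain ⟨s, hs, hsQ⟩ := (hB i).1 hi
  refine (hB' _).2 ⟨_, RootAdjoinChart.of_mem 𝒮 d u a 𝒯 h𝒯 hs, fun h => hsQ ?_⟩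
  rw [← h𝔔', Ideal.mem_comap]; exact h

omit [NeZero d] in
/-- `u ∉ 𝔔 ⇒ (a, 1) ∈ B̃` (`w^d = u`; `d ≥ 2`, `𝔔̃` prime). [folklore] -/
theorem root_mem_unitDegrees [𝔔'.IsPrime] [Fact (1 < d)] (huQ : u ∉ 𝔔) : (a, (1 : ZMod d)) ∈ B' := by
  have _ := hB
  refine (hB' _).2 ⟨_, RootAdjoinChart.root_mem 𝒮 d u a 𝒯 h𝒯, fun h => huQ ?_⟩
  rw [← h𝔔', Ideal.mem_comap, ← RootAdjoinChart.root_pow_eq d u]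
  exact 𝔔'.pow_mem_of_mem h d (Nat.pos_of_ne_zero (NeZero.ne d))

omit [DecidableEq A] [GradedAlgebra 𝒮] [NeZero d] in
/-- `(i, m) ∈ B̃ ⇒ i − m•a ∈ B`. [folklore] -/
theorem sub_mem_of_mem_unitDegrees {p : A × ZMod d} (hp : p ∈ B') : p.1 - p.2.val • a ∈ B := by
  obtain ⟨x, hx, hxQ⟩ := (hB' p).1 hp
  obtain ⟨c, hc, rfl⟩ := (h𝒯 p x).1 hx
  refine (hB _).2 ⟨c, hc, fun hcQ => hxQ (𝔔'.mul_mem_right _ ?_)⟩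
  rw [← h𝔔', Ideal.mem_comap] at hcQ; exact hcQ

omit [NeZero d] in
/-- ★ **`B ⊔ ⟨a⟩ = ⊤ ⇒ B̃ ⊔ (0 × ZMod d) = ⊤`.** [folklore] -/
theorem sup_prod_eq_top [𝔔'.IsPrime] [Fact (1 < d)] (huQ : u ∉ 𝔔) (hgen : B ⊔ AddSubgroup.zmultiples a = ⊤) :
    B' ⊔ (⊥ : AddSubgroup A).prod (⊤ : AddSubgroup (ZMod d)) = ⊤ := by
  rw [eq_top_iff]
  rintro ⟨i, m⟩ -
  have hi : i ∈ B ⊔ AddSubgroup.zmultiples a := by rw [hgen]; exact AddSubgroup.mem_top i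
  obtain ⟨β, hβ, z', hz', rfl⟩ := AddSubgroup.mem_sup.1 hi
  obtain ⟨z, rfl⟩ := AddSubgroup.mem_zmultiples_iff.1 hz'
  have h1 : ((β, (0 : ZMod d)) : A × ZMod d) + z • (a, (1 : ZMod d)) ∈ B' :=
    add_mem (mem_unitDegrees_of_mem 𝒮 d u a 𝒯 h𝒯 𝔔 𝔔' h𝔔' B hB B' hB' hβ)
      (zsmul_mem (root_mem_unitDegrees 𝒮 d u a 𝒯 h𝒯 𝔔 𝔔' h𝔔' B hB B' hB' huQ) z)
  have h2 : ((0 : A), m - z • (1 : ZMod d)) ∈ (⊥ : AddSubgroup A).prod (⊤ : AddSubgroup (ZMod d)) :=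
    AddSubgroup.mem_prod.2 ⟨AddSubgroup.mem_bot.2 rfl, AddSubgroup.mem_top _⟩
  have heq : ((β, (0 : ZMod d)) : A × ZMod d) + z • (a, (1 : ZMod d)) + ((0 : A), m - z • (1 : ZMod d)) = (β + z • a, m) := by
    ext <;> simp
  rw [← heq]
  exact add_mem (AddSubgroup.mem_sup_left h1) (AddSubgroup.mem_sup_right h2)

omit [DecidableEq A] [GradedAlgebra 𝒮] in
/-- ★ **`j • a ∉ B` for `0 < j < d` ⇒ `B̃ ⊓ (0 × ZMod d) = ⊥`.** [folklore] -/
theorem inf_prod_eq_bot (hmin : ∀ j : ℕ, 0 < j → j < d → j • a ∉ B) :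
    B' ⊓ (⊥ : AddSubgroup A).prod (⊤ : AddSubgroup (ZMod d)) = ⊥ := by
  rw [eq_bot_iff]
  rintro ⟨i, m⟩ ⟨hpB, hpC⟩
  have hi : i = 0 := AddSubgroup.mem_bot.1 (AddSubgroup.mem_prod.1 hpC).1
  subst hi
  have hm : m.val • a ∈ B := by
    have h := sub_mem_of_mem_unitDegrees 𝒮 d u a 𝒯 h𝒯 𝔔 𝔔' h𝔔' B hB B' hB' hpB
    rw [zero_sub] at h
    exact (neg_mem_iff).1 h
  have hm0 : m = 0 := by
    by_contra hm0
    exact hmin m.val (ZMod.val_pos.2 hm0) m.val_lt hm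
  subst hm0
  exact AddSubgroup.mem_bot.2 rfl

end Units

end Summit.ResolutionOfSingularities.ResolutionOfSingularities.Theorems.FRationalResolution.RootAdjoinUnits

end
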